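import Mathlib
import Summits.NavierStokesRegularity.NavierStokesRegularity.Theorems.L3TimeExponentPincerQuantJawEnergyLine
import HarnessLib.Audit
import HarnessLib

/-!
# L3TimeExponentPincer — the persistence exponent of an `L³`-critical eddy is exactly `2`
# (`LpPersistence 3 (1/2) a ↔ 2 ≤ a`), and the data-critical jaw below the energy line

Support kernel for the crux `L3CascadeJaw` (item stmt-NavierStokesRegularity-19499); sequel of
`…QuantJawEnergyLine` (`QuantJaw q ↔ q ≤ 4`) and `…RingPersistenceHolds` (`LpPersistence 3 (1/2) 2`).

* `lpPersistence_of_exponent_le` — monotonicity in the lifetime exponent: a family persisting on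
  `(0, cℓ^a)` persists on every shorter window `(0, cℓ^{a'})`, `a ≤ a'` (`ℓ ≤ 1`);
* `not_lpPersistence_three_half_of_lt_two` — **no energy-normalised family keeps
  `‖u(t)‖₃ ≥ c ℓ^{-1/2}` for `≍ ℓ^a` with `a < 2`**: such a family would refute `QuantJaw q` for
  some `q ≤ 4` (threshold theorem `not_quantBound_of_persistence`), contradicting `quantJaw_four`
  (energy × dissipation).  Viscosity kills an eddy of size `ℓ` in the `L³` sense within `O(ℓ²/ν)`;
* `lpPersistence_three_half_iff : 0 ≤ a → (LpPersistence 3 (1/2) a ↔ 2 ≤ a)` — the rings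
  (`a = 2`, `≍ Re` turnovers) are optimal;
* `quantJawData_of_quantJaw`, `quantJawData_of_le_four` — below the energy line the data-critical
  jaw `QuantJawData q` is (trivially) a theorem; above it is the open rung whose modulus is
  `≳ A^{q-4}` (`quantJawData_modulus_lower_ring`).

WHAT THIS IS NOT: not NS regularity or blow-up; statements about (E₀, ν, T)-uniform constants and
explicit smooth families; the crux `L3CascadeJaw` is untouched; no crux claim.
-/

namespace Summit.NavierStokesRegularity.NavierStokesRegularity.Theorems.L3TimeExponentPincerPersistenceExponent

open MeasureTheory Set Literature.Analysis.FluidPDE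
open Summit.NavierStokesRegularity.NavierStokesRegularity.Theorems.L3TimeExponentPincerQuantJaw
open Summit.NavierStokesRegularity.NavierStokesRegularity.Theorems.L3TimeExponentPincerRingPersistenceHolds
open Summit.NavierStokesRegularity.NavierStokesRegularity.Theorems.L3TimeExponentPincerQuantJawEnergyLine
open scoped ENNReal NNReal

/-- **Monotonicity of persistence in the lifetime exponent**: `LpPersistence p β a → a ≤ a' →
LpPersistence p β a'` (for `ℓ ≤ 1` the window `(0, cℓ^{a'})` is inside `(0, cℓ^{a})`). -/
theorem lpPersistence_of_exponent_le {p : ℝ≥0∞} {β a a' : ℝ} (h : LpPersistence p β a)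
    (haa' : a ≤ a') : LpPersistence p β a' := by
  obtain ⟨c, hc, hc1, hfam⟩ := h
  refine ⟨c, hc, hc1, fun ℓ hℓ hℓ1 => ?_⟩
  obtain ⟨u, pr, hF, hE, hfloor⟩ := hfam ℓ hℓ hℓ1
  refine ⟨u, pr, hF, hE, fun t ht => hfloor t ⟨ht.1, ht.2.trans_le ?_⟩⟩
  exact mul_le_mul_of_nonneg_left (Real.rpow_le_rpow_of_exponent_ge hℓ hℓ1 haa') hc.le

/-- **No `L³` persistence beyond the viscous lifetime**: `LpPersistence 3 (1/2) a` fails for every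
`0 ≤ a < 2`.  (It would refute the uniform jaw at the exponent `q = 4`, which holds by energy ×
dissipation: `quantJaw_four`.) -/
theorem not_lpPersistence_three_half_of_lt_two {a : ℝ} (ha0 : 0 ≤ a) (ha2 : a < 2) :
    ¬ LpPersistence 3 (1 / 2) a := fun hP =>
  not_quantBound_of_persistence (q := 4) ha0 (by norm_num) hP (by linarith) quantJaw_four

/-- **The persistence exponent of an `L³`-critical eddy is exactly `2`**: for `0 ≤ a`,
`LpPersistence 3 (1/2) a ↔ 2 ≤ a` (`⇐`: the rings, `lpPersistence_three_half_two`, and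
monotonicity; `⇒`: `not_lpPersistence_three_half_of_lt_two`). -/
theorem lpPersistence_three_half_iff {a : ℝ} (ha0 : 0 ≤ a) : LpPersistence 3 (1 / 2) a ↔ 2 ≤ a :=
  ⟨fun h => le_of_not_gt fun h2 => not_lpPersistence_three_half_of_lt_two ha0 h2 h,
    fun h2 => lpPersistence_of_exponent_le lpPersistence_three_half_two h2⟩

/-- The uniform jaw implies the data-critical jaw (the data slice is ignored). -/
theorem quantJawData_of_quantJaw {q : ℝ} (h : QuantJaw q) : QuantJawData q := by
  intro ν T E A hν hT hE _hA
  obtain ⟨B, hB⟩ := h ν T E hν hT hE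
  exact ⟨B, fun u pr hF hEu _ => hB u pr hF hEu⟩

/-- **Below the energy line the data-critical jaw is a theorem**: `QuantJawData q` for every
`0 ≤ q ≤ 4` (from `quantJaw_of_le_four`).  Above the line it is the surviving open rung
(`l3CascadeJaw_of_quantJawData`), calibrated by `quantJawData_modulus_lower_ring`. -/
theorem quantJawData_of_le_four {q : ℝ} (hq0 : 0 ≤ q) (hq4 : q ≤ 4) : QuantJawData q :=
  quantJawData_of_quantJaw (quantJaw_of_le_four hq0 hq4)

/--
info: 'Summit.NavierStokesRegularity.NavierStokesRegularity.Theorems.L3TimeExponentPincerPersistenceExponent.lpPersistence_three_half_iff' depends on axioms: [propext,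
 Classical.choice,
 Quot.sound]
-/
#guard_msgs in
#print axioms lpPersistence_three_half_iff

end Summit.NavierStokesRegularity.NavierStokesRegularity.Theorems.L3TimeExponentPincerPersistenceExponent
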